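import Summits.HodgeConjecture.HodgeConjecture.Theorems.Ring2WeilNormObstructionDescent
import Summits.HodgeConjecture.HodgeConjecture.Theorems.Ring2WeilCoverageNormCriteria
import HarnessLib

/-!
# Non-split certificates for the class `[6]` of `ℚ(√-19)`, `ℚ(√-43)`, `ℚ(√-67)`, `ℚ(√-163)`

research route conditional on HC_CM; not a corollary; Q11.4-sentence-2 already refuted in dim ≥ 3.

Cell `pub-hodge-ring2`, binder seat `ring2-b02` (gen 51), WEIL-TYPE FAMILY-COVERAGE CENSUS
(`run/shared/lean/pub/pub-hodge-ring2/WEIL-FAMILY-COVERAGE.md` §b02.9): the census rows `W6.d.6`,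
`d ∈ {19, 43, 67, 163}` (obstruction set `T(6) = {2, 3}`), are the rows on which the binary-tetrahedral
Prym sixfolds of §b02.9 land for these four class-number-one fields; ring2-b04's
`Ring2WeilCoverageNormTableB` certifies `2 ∉ Nm` and `3 ∉ Nm` for them (classes `[2]`, `T = {2, d}`, and
`[3]`, `T = {3, d}`), not `6`. Here: `6 ∉ Nm(K_dˣ)`, `K_d = ℚ(√-d)`
(`Motives.normUnitsSubgroup ℚ (VanGeemen1994.weilField d)`), each at the INERT prime `3 ∥ 6`
(`-d` is a non-square mod `3`; ring2-b04's `Ring2.WeilCoverage.natCast_not_mem_normUnitsSubgroup_of_inert`),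
and the class form `[-6] ≠ Ring2.Hypotheses.splitDiscriminantClass n d` for every ODD `n` (sixfolds,
tenfolds) and `[6] ≠ …` for every EVEN `n` via this seat's
`mk_ne_splitDiscriminantClass_of_even` (fourfolds, eightfolds). Nothing here is about Hodge classes:
these are the arithmetic «(F1) NO hyperbolic member» cells of the census (Landherr / van Geemen (5.4.1):
hyperbolic ⟺ `a ∈ Nm(K^×)`, in the tree `VanGeemen1994.isHyperbolicWeilType_iff_hasWeilDiscriminantNondeg_split`).

| `K` | `d` | `a` | `T(a)` | certificate prime |
|---|---|---|---|---|
| `ℚ(√-19)` | 19 | 6 | {2, 3} | inert 3 |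
| `ℚ(√-43)` | 43 | 6 | {2, 3} | inert 3 |
| `ℚ(√-67)` | 67 | 6 | {2, 3} | inert 3 |
| `ℚ(√-163)` | 163 | 6 | {2, 3} | inert 3 |

## References
* B. van Geemen, LNM 1594 (1994), Lemma 5.2, 5.4 and (5.4.1) (after W. Landherr 1936). [vanGeemen1994HodgeAV]
* J.-P. Serre, *A Course in Arithmetic* (1973), Ch. III §1 (Hilbert symbols). [Serre1973]
-/

open Literature.AlgebraicGeometry.Motives
open Literature.AlgebraicGeometry.VanGeemen1994
open Summit.HodgeConjecture.HodgeConjecture.Ring2.Hypotheses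
open Summit.HodgeConjecture.HodgeConjecture.Ring2.WeilCoverage

namespace Summit.HodgeConjecture.Ring2WeilNormDescent

/-! ### `K = ℚ(√-19)` (`d = 19`) -/

namespace SqrtNeg19

/-- `6 ∉ Nm(ℚ(√-19)ˣ)`, `T(6) = {2, 3}`, at the inert prime `3 ∥ 6` (`-19` non-square mod `3`). research route conditional on HC_CM; not a corollary; Q11.4-sentence-2 already refuted in dim ≥ 3. [cite: vanGeemen1994HodgeAV, (5.4.1)] -/
theorem not_mem_6 : Units.mk0 (6 : ℚ) (by norm_num) ∉ normUnitsSubgroup ℚ (weilField 19) := by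
  simpa using natCast_not_mem_normUnitsSubgroup_of_inert (d := 19) (a := 6) (p := 3)
    (by norm_num) (by decide) (by norm_num) (by norm_num) (by norm_num)

/-- `[-6] ≠ split`: the components `(n, ℚ(√-19), a ≡ 6)`, `n` odd (sixfolds, tenfolds: rows W6.19.6, W10.19.6), have NO hyperbolic member. research route conditional on HC_CM; not a corollary; Q11.4-sentence-2 already refuted in dim ≥ 3. [cite: vanGeemen1994HodgeAV, (5.4.1)] -/
theorem neg_6_ne_split_of_odd {n : ℕ} (hn : Odd n) :
    (QuotientGroup.mk (Units.mk0 (-6 : ℚ) (by norm_num)) : weilNormResidueGroup 19) ≠ splitDiscriminantClass n 19 :=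
  mk_neg_ne_splitDiscriminantClass_of_odd _ not_mem_6 hn

/-- `[6] ≠ split`: the components `(n, ℚ(√-19), a ≡ 6)`, `n ≥ 2` even (fourfolds, eightfolds: rows W4.19.6, W8.19.6), have NO hyperbolic member. research route conditional on HC_CM; not a corollary; Q11.4-sentence-2 already refuted in dim ≥ 3. [cite: vanGeemen1994HodgeAV, (5.4.1)] -/
theorem pos_6_ne_split_of_even {n : ℕ} (hn : Even n) :
    (QuotientGroup.mk (Units.mk0 (6 : ℚ) (by norm_num)) : weilNormResidueGroup 19) ≠ splitDiscriminantClass n 19 :=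
  mk_ne_splitDiscriminantClass_of_even _ not_mem_6 hn

end SqrtNeg19

/-! ### `K = ℚ(√-43)` (`d = 43`) -/

namespace SqrtNeg43

/-- `6 ∉ Nm(ℚ(√-43)ˣ)`, `T(6) = {2, 3}`, at the inert prime `3 ∥ 6` (`-43` non-square mod `3`). research route conditional on HC_CM; not a corollary; Q11.4-sentence-2 already refuted in dim ≥ 3. [cite: vanGeemen1994HodgeAV, (5.4.1)] -/
theorem not_mem_6 : Units.mk0 (6 : ℚ) (by norm_num) ∉ normUnitsSubgroup ℚ (weilField 43) := by
  simpa using natCast_not_mem_normUnitsSubgroup_of_inert (d := 43) (a := 6) (p := 3)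
    (by norm_num) (by decide) (by norm_num) (by norm_num) (by norm_num)

/-- `[-6] ≠ split`: the components `(n, ℚ(√-43), a ≡ 6)`, `n` odd (sixfolds, tenfolds: rows W6.43.6, W10.43.6), have NO hyperbolic member. research route conditional on HC_CM; not a corollary; Q11.4-sentence-2 already refuted in dim ≥ 3. [cite: vanGeemen1994HodgeAV, (5.4.1)] -/
theorem neg_6_ne_split_of_odd {n : ℕ} (hn : Odd n) :
    (QuotientGroup.mk (Units.mk0 (-6 : ℚ) (by norm_num)) : weilNormResidueGroup 43) ≠ splitDiscriminantClass n 43 :=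
  mk_neg_ne_splitDiscriminantClass_of_odd _ not_mem_6 hn

/-- `[6] ≠ split`: the components `(n, ℚ(√-43), a ≡ 6)`, `n ≥ 2` even (fourfolds, eightfolds: rows W4.43.6, W8.43.6), have NO hyperbolic member. research route conditional on HC_CM; not a corollary; Q11.4-sentence-2 already refuted in dim ≥ 3. [cite: vanGeemen1994HodgeAV, (5.4.1)] -/
theorem pos_6_ne_split_of_even {n : ℕ} (hn : Even n) :
    (QuotientGroup.mk (Units.mk0 (6 : ℚ) (by norm_num)) : weilNormResidueGroup 43) ≠ splitDiscriminantClass n 43 :=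
  mk_ne_splitDiscriminantClass_of_even _ not_mem_6 hn

end SqrtNeg43

/-! ### `K = ℚ(√-67)` (`d = 67`) -/

namespace SqrtNeg67

/-- `6 ∉ Nm(ℚ(√-67)ˣ)`, `T(6) = {2, 3}`, at the inert prime `3 ∥ 6` (`-67` non-square mod `3`). research route conditional on HC_CM; not a corollary; Q11.4-sentence-2 already refuted in dim ≥ 3. [cite: vanGeemen1994HodgeAV, (5.4.1)] -/
theorem not_mem_6 : Units.mk0 (6 : ℚ) (by norm_num) ∉ normUnitsSubgroup ℚ (weilField 67) := by
  simpa using natCast_not_mem_normUnitsSubgroup_of_inert (d := 67) (a := 6) (p := 3)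
    (by norm_num) (by decide) (by norm_num) (by norm_num) (by norm_num)

/-- `[-6] ≠ split`: the components `(n, ℚ(√-67), a ≡ 6)`, `n` odd (sixfolds, tenfolds: rows W6.67.6, W10.67.6), have NO hyperbolic member. research route conditional on HC_CM; not a corollary; Q11.4-sentence-2 already refuted in dim ≥ 3. [cite: vanGeemen1994HodgeAV, (5.4.1)] -/
theorem neg_6_ne_split_of_odd {n : ℕ} (hn : Odd n) :
    (QuotientGroup.mk (Units.mk0 (-6 : ℚ) (by norm_num)) : weilNormResidueGroup 67) ≠ splitDiscriminantClass n 67 :=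
  mk_neg_ne_splitDiscriminantClass_of_odd _ not_mem_6 hn

/-- `[6] ≠ split`: the components `(n, ℚ(√-67), a ≡ 6)`, `n ≥ 2` even (fourfolds, eightfolds: rows W4.67.6, W8.67.6), have NO hyperbolic member. research route conditional on HC_CM; not a corollary; Q11.4-sentence-2 already refuted in dim ≥ 3. [cite: vanGeemen1994HodgeAV, (5.4.1)] -/
theorem pos_6_ne_split_of_even {n : ℕ} (hn : Even n) :
    (QuotientGroup.mk (Units.mk0 (6 : ℚ) (by norm_num)) : weilNormResidueGroup 67) ≠ splitDiscriminantClass n 67 :=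
  mk_ne_splitDiscriminantClass_of_even _ not_mem_6 hn

end SqrtNeg67

/-! ### `K = ℚ(√-163)` (`d = 163`) -/

namespace SqrtNeg163

/-- `6 ∉ Nm(ℚ(√-163)ˣ)`, `T(6) = {2, 3}`, at the inert prime `3 ∥ 6` (`-163` non-square mod `3`). research route conditional on HC_CM; not a corollary; Q11.4-sentence-2 already refuted in dim ≥ 3. [cite: vanGeemen1994HodgeAV, (5.4.1)] -/
theorem not_mem_6 : Units.mk0 (6 : ℚ) (by norm_num) ∉ normUnitsSubgroup ℚ (weilField 163) := by
  simpa using natCast_not_mem_normUnitsSubgroup_of_inert (d := 163) (a := 6) (p := 3)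
    (by norm_num) (by decide) (by norm_num) (by norm_num) (by norm_num)

/-- `[-6] ≠ split`: the components `(n, ℚ(√-163), a ≡ 6)`, `n` odd (sixfolds, tenfolds: rows W6.163.6, W10.163.6), have NO hyperbolic member. research route conditional on HC_CM; not a corollary; Q11.4-sentence-2 already refuted in dim ≥ 3. [cite: vanGeemen1994HodgeAV, (5.4.1)] -/
theorem neg_6_ne_split_of_odd {n : ℕ} (hn : Odd n) :
    (QuotientGroup.mk (Units.mk0 (-6 : ℚ) (by norm_num)) : weilNormResidueGroup 163) ≠ splitDiscriminantClass n 163 :=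
  mk_neg_ne_splitDiscriminantClass_of_odd _ not_mem_6 hn

/-- `[6] ≠ split`: the components `(n, ℚ(√-163), a ≡ 6)`, `n ≥ 2` even (fourfolds, eightfolds: rows W4.163.6, W8.163.6), have NO hyperbolic member. research route conditional on HC_CM; not a corollary; Q11.4-sentence-2 already refuted in dim ≥ 3. [cite: vanGeemen1994HodgeAV, (5.4.1)] -/
theorem pos_6_ne_split_of_even {n : ℕ} (hn : Even n) :
    (QuotientGroup.mk (Units.mk0 (6 : ℚ) (by norm_num)) : weilNormResidueGroup 163) ≠ splitDiscriminantClass n 163 :=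
  mk_ne_splitDiscriminantClass_of_even _ not_mem_6 hn

end SqrtNeg163

end Summit.HodgeConjecture.Ring2WeilNormDescent
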